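import Mathlib
import HarnessLib
import Literature.Analysis.FluidPDE.FiniteFourierModeEulerLune

/-!
# Frame-independent composition of strain envelopes: a planar shear block in ANY orthonormal frame
# (instab lane, door O-acc = O7, obstruction P3 — the rope half of the θ-envelope of `HEREDITY-P3.md` v1.4)

HONEST FRAMING (cell `ns-blowup`, seat `ns-blowup-instab2`; human ruling D-0035): nothing here is a
claim about Navier–Stokes blow-up. WHAT THIS IS NOT: not dynamics; it is the `3 × 3` linear algebra that
turns the kernel one-tube strain cap of a Gaussian core (`|S₁₂| ≤ (3/20)|ω₀|` in the core's own transverse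
frame, `LambOseenStrainField.strain_offdiag_abs_le`, p406430) into a bound on the stretching rate of EVERY
line element in EVERY frame, so that `ABCHostStrainEnvelope.envelope_add` (p409462) applies to a rope whose
axis points anywhere (for the P-TOWER rope: along a body diagonal).

* `shear_quadForm_le`: for the planar shear block `T = [[0, S, 0], [S, 0, 0], [0, 0, 0]]` (a columnar
  vortex's rate of strain in its own frame: axis = third coordinate, principal shear `S`),
  `|vᵀ T v| = |2 S v₀ v₁| ≤ |S| · |v|²`;
* `quadForm_conj_orthogonal`: for an orthogonal `Q` (`Qᵀ Q = 1`), `vᵀ (Qᵀ T Q) v = (Qv)ᵀ T (Qv)` and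
  `|Qv|² = |v|²` (`normSq_mulVec_orthogonal`);
* `shear_quadForm_le_any_frame`: hence `|vᵀ (Qᵀ T Q) v| ≤ |S| · |v|²` for every orthogonal `Q` — the cap
  holds for a rope with ANY axis direction; with `|S| ≤ (3/20)|ω₀|` this is the hypothesis `hT` of
  `envelope_add` with `s = (3/20)|ω₀|` (`rope_cap_any_frame`).

Mathlib + `Literature.Analysis.FluidPDE.FiniteFourierModeEulerLune` (only for the tree's `KY.dotProduct_self_fin3 :
v ⬝ᵥ v = v₀² + v₁² + v₂²`, reused instead of restated). No definitions. LABEL: MODEL-door bookkeeping.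
-/

namespace Summit.NavierStokesRegularity.FluidComputer.StrainEnvelopeComposition

open Matrix
open Literature.Analysis.FluidPDE.KY (dotProduct_self_fin3)

/-- The planar shear block's quadratic form: `vᵀ T v = 2 S v₀ v₁` for `T = [[0,S,0],[S,0,0],[0,0,0]]`. -/
theorem shear_quadForm_eq (S : ℝ) (v : Fin 3 → ℝ) :
    v ⬝ᵥ ((!![0, S, 0; S, 0, 0; 0, 0, 0] : Matrix (Fin 3) (Fin 3) ℝ).mulVec v) = 2 * S * (v 0 * v 1) := by
  simp [Matrix.mulVec, dotProduct, Fin.sum_univ_three]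
  ring

/-- ONE-FRAME CAP: `|vᵀ T v| ≤ |S| · |v|²` (from `2|v₀ v₁| ≤ v₀² + v₁² ≤ |v|²`). -/
theorem shear_quadForm_le (S : ℝ) (v : Fin 3 → ℝ) :
    |v ⬝ᵥ ((!![0, S, 0; S, 0, 0; 0, 0, 0] : Matrix (Fin 3) (Fin 3) ℝ).mulVec v)| ≤ |S| * (v ⬝ᵥ v) := by
  rw [shear_quadForm_eq, dotProduct_self_fin3]
  have h2 : |2 * (v 0 * v 1)| ≤ v 0 ^ 2 + v 1 ^ 2 := by
    rw [abs_le]; constructor <;> nlinarith [sq_nonneg (v 0 + v 1), sq_nonneg (v 0 - v 1)]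
  have hv2 : 0 ≤ v 2 ^ 2 := sq_nonneg _
  calc |2 * S * (v 0 * v 1)| = |S| * |2 * (v 0 * v 1)| := by
        rw [show 2 * S * (v 0 * v 1) = S * (2 * (v 0 * v 1)) by ring, abs_mul]
    _ ≤ |S| * (v 0 ^ 2 + v 1 ^ 2) := mul_le_mul_of_nonneg_left h2 (abs_nonneg S)
    _ ≤ |S| * (v 0 ^ 2 + v 1 ^ 2 + v 2 ^ 2) := by
        apply mul_le_mul_of_nonneg_left _ (abs_nonneg S); linarith

/-- FRAME CHANGE: for any matrices, `vᵀ (Qᵀ T Q) v = (Qv)ᵀ T (Qv)`. -/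
theorem quadForm_conj (Q T : Matrix (Fin 3) (Fin 3) ℝ) (v : Fin 3 → ℝ) :
    v ⬝ᵥ ((Qᵀ * T * Q).mulVec v) = (Q.mulVec v) ⬝ᵥ (T.mulVec (Q.mulVec v)) := by
  rw [← Matrix.mulVec_mulVec, ← Matrix.mulVec_mulVec, Matrix.dotProduct_mulVec, Matrix.vecMul_transpose]

/-- An orthogonal matrix preserves the squared length: `Qᵀ Q = 1 ⇒ (Qv) ⬝ᵥ (Qv) = v ⬝ᵥ v`. -/
theorem normSq_mulVec_orthogonal (Q : Matrix (Fin 3) (Fin 3) ℝ) (hQ : Qᵀ * Q = 1) (v : Fin 3 → ℝ) :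
    (Q.mulVec v) ⬝ᵥ (Q.mulVec v) = v ⬝ᵥ v := by
  rw [Matrix.dotProduct_mulVec, ← Matrix.mulVec_transpose, Matrix.mulVec_mulVec, hQ, Matrix.one_mulVec]

/-- ANY-FRAME CAP: for every orthogonal `Q`, `|vᵀ (Qᵀ T Q) v| ≤ |S| · |v|²` — the one-tube strain cap holds
for a columnar core whose axis points in ANY direction (its rate of strain in the lab frame is `Qᵀ T Q` for
the rotation `Q` taking lab coordinates to the core's frame). -/
theorem shear_quadForm_le_any_frame (S : ℝ) (Q : Matrix (Fin 3) (Fin 3) ℝ) (hQ : Qᵀ * Q = 1)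
    (v : Fin 3 → ℝ) :
    |v ⬝ᵥ ((Qᵀ * (!![0, S, 0; S, 0, 0; 0, 0, 0] : Matrix (Fin 3) (Fin 3) ℝ) * Q).mulVec v)| ≤
      |S| * (v ⬝ᵥ v) := by
  rw [quadForm_conj, ← normSq_mulVec_orthogonal Q hQ v]
  exact shear_quadForm_le S (Q.mulVec v)

/-- THE ROPE HALF OF THE θ-ENVELOPE: if the core's principal shear obeys the kernel Gaussian cap
`|S| ≤ (3/20)|ω₀|` (`LambOseenStrainField.strain_offdiag_abs_le`), then in every frame and every direction
`vᵀ T_lab v ≤ (3/20)|ω₀| · (v₀² + v₁² + v₂²)` — exactly the hypothesis `hT` of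
`ABCHostStrainEnvelope.envelope_add` with `s = (3/20)|ω₀|`, whence `λ_max(S_host + S_rope) ≤ √2 + (3/20)|ω₀|`. -/
theorem rope_cap_any_frame (S ω₀ : ℝ) (hS : |S| ≤ 3 / 20 * |ω₀|) (Q : Matrix (Fin 3) (Fin 3) ℝ)
    (hQ : Qᵀ * Q = 1) (v : Fin 3 → ℝ) :
    v ⬝ᵥ ((Qᵀ * (!![0, S, 0; S, 0, 0; 0, 0, 0] : Matrix (Fin 3) (Fin 3) ℝ) * Q).mulVec v) ≤
      3 / 20 * |ω₀| * (v 0 ^ 2 + v 1 ^ 2 + v 2 ^ 2) := by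
  have h := shear_quadForm_le_any_frame S Q hQ v
  rw [dotProduct_self_fin3] at h
  have hv : 0 ≤ v 0 ^ 2 + v 1 ^ 2 + v 2 ^ 2 := by positivity
  calc v ⬝ᵥ ((Qᵀ * (!![0, S, 0; S, 0, 0; 0, 0, 0] : Matrix (Fin 3) (Fin 3) ℝ) * Q).mulVec v)
      ≤ |v ⬝ᵥ ((Qᵀ * (!![0, S, 0; S, 0, 0; 0, 0, 0] : Matrix (Fin 3) (Fin 3) ℝ) * Q).mulVec v)| := le_abs_self _
    _ ≤ |S| * (v 0 ^ 2 + v 1 ^ 2 + v 2 ^ 2) := h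
    _ ≤ 3 / 20 * |ω₀| * (v 0 ^ 2 + v 1 ^ 2 + v 2 ^ 2) := mul_le_mul_of_nonneg_right hS hv

end Summit.NavierStokesRegularity.FluidComputer.StrainEnvelopeComposition
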